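import Summits.BirchSwinnertonDyer.BirchSwinnertonDyer.Theses.ResidualThetaTransportAtTwo
import HarnessLib

/-!
# Route `ResidualThetaTransportAtTwo`: the glue `ResidualThetaCountLowerAtTwoGlue` ((R≥)ᵖ → OfPure → RTC≥) HOLDS

The route pen's split of RTC≥ `ResidualThetaCountLowerAtTwo` (stmt-BirchSwinnertonDyer-25435; pen bsd-wall-p2 g16 WINDOW 6 =
RGE-V1, route rev 28, after lead rtt-p2 g8's memo `Cruxes/ResidualThetaCountAtTwo/RGE-RESTATEMENT-g8.md`) into the pure crux
(R≥)ᵖ `ResidualThetaCountLowerPureAtTwo` (26074: RTC≥ with the uniform-family premise `∀ c, P(c) →` and the `+ c` deleted) and the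
fact-relative bridge `ResidualThetaCountLowerAtTwoOfPure := (R≥)ᵖ → RTC≥` (26075; kernel form modulo PUB-G ∧ GZK =
`ResidualThetaLayer.residualThetaCountLowerAtTwo_of_residualLower`, p606001) carries the glue item 26076
`ResidualThetaCountLowerAtTwoGlue := (R≥)ᵖ → ((R≥)ᵖ → RTC≥) → RTC≥` — modus ponens; this file is its one-line closer.
THEOREM ONLY; closes the GLUE item, not the crux; BSD is not proved by this.
-/

set_option autoImplicit false
-- the Theorems namespace of this sub repeats the summit name by design (D-0017 nested layout)
set_option linter.dupNamespace false

namespace Summit.BirchSwinnertonDyer.BirchSwinnertonDyer.Theorems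

/-- **`ResidualThetaCountLowerAtTwoGlue` holds** (modus ponens): the pure one-sided residual theta count (R≥)ᵖ and the bridge
(R≥)ᵖ → RTC≥ give the relative count RTC≥ `ResidualThetaCountLowerAtTwo`. [folklore] -/
theorem residualThetaCountLowerAtTwoGlue_proof :
    Summit.BirchSwinnertonDyer.BirchSwinnertonDyer.Theses.ResidualThetaTransportAtTwo.ResidualThetaCountLowerAtTwoGlue :=
  fun hPure hOfPure ↦ hOfPure hPure

end Summit.BirchSwinnertonDyer.BirchSwinnertonDyer.Theorems
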